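import Mathlib.Analysis.InnerProductSpace.Orthonormal
import Literature.MathematicalPhysics.QuantumLattice.PairFieldPairedVectors
import Literature.MathematicalPhysics.QuantumLattice.FreeFermionSectorEnergyDeviation
import Literature.MathematicalPhysics.QuantumLattice.PairCorrelationsProofs

/-!
# Crux `WindowInfraredBound` (item `stmt-HubbardSuperconductivity-1089`), negative side:
# Dicke superpositions of momentum-space paired vectors

Finite-dimensional bookkeeping for the witness of `…/Negative/AllSectorStates.lean` (the ground-state
hypothesis of the crux is load-bearing).  Everything is about the paired product vectors of
`Literature/…/PairedProductStates.lean`,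

  `Φ_T = Π_{k ∈ T} b†_k |0⟩`,  `b†_k = (pairMode k)ᴴ = c†_{k↑} c†_{−k↓}`,  `T ⊆ (ℤ/Lℤ)²` finite,

written, as there, as literal terms `(T.toList.map (pairMode ·)ᴴ).prod *ᵥ vacuum` (no definition, no
notation), and about the DICKE SUPERPOSITION over `n`-subsets of a mode set `K` on top of an inert filled
block `F` (disjoint from `K`),

  `Ψ = Σ_{S ⊆ K, |S| = n} Φ_{F ∪ S}`   (a literal sum over `powersetCard n K`).

* `momentumNumber_up_mulVec_paired`, `star_paired_dotProduct_paired` — `n_{k↑} Φ_T = [k ∈ T] Φ_T`, hence the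
  paired vectors are ORTHONORMAL: `⟨Φ_T, Φ_{T'}⟩ = [T = T']`.
* `star_dicke_dotProduct_dicke` — `⟨Ψ, Ψ⟩ = C(|K|, n)`;  `dicke_mem_szSector` — `Ψ ∈ szSector (2(|F| + n)) 0`.
* `weightedPairMode_mulVec_paired` — a weighted pair annihilator `B_W = Σ_k W_k b_k` lowers mode by mode,
  `B_W Φ_T = Σ_{k ∈ T} W_k Φ_{T∖k}` (`pairMode_mulVec_paired` of the Literature file);
* `star_paired_dotProduct_weightedPairMode_mulVec_dicke` — its matrix elements against the `(n-1)`-layer: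
  `⟨Φ_{F ∪ R}, B_W Ψ⟩ = Σ_{k ∈ K∖R} W_k` for `R ⊆ K`, `|R| = n - 1` (exactly the `n`-sets `S = R ∪ {k}` feed `R`);
* `dicke_weightedPairMode_lower_bound` — by Bessel's inequality over that orthonormal layer,
  `‖B_W Ψ‖² ≥ C(|K|, n-1) · (a (|K| - n + 1))²` whenever `Re W_k ≥ a ≥ 0` on `K`:  the `Θ(n · |K|)`
  COHERENT ENHANCEMENT of a pair condensate (for `W ≡ 1` the exact value is `n(|K|-n+1) C(|K|,n)`, the
  spin-`|K|/2` Dicke matrix element).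

No Jordan–Wigner sign enters: pair creators are even and commute (`pairMode_comm`).  Sources: R. H. Dicke,
Phys. Rev. 93 (1954) 99 (symmetric superpositions); C. N. Yang, Rev. Mod. Phys. 34 (1962) 694, §5
(`η`-pair condensates, `⟨η†η⟩ = n(M-n+1)`); J. von Delft, D. C. Ralph, Phys. Rep. 345 (2001) 61, §4.2.3
(hard-core-boson pair operators).  Workfile: `Cruxes/WindowInfraredBound/Disproof.lean` §5.
-/

-- the mandated namespace `Summit.<Summit>.<Problem>.Theorems` repeats `HubbardSuperconductivity`
-- (single-problem summit, D-0017), which the `dupNamespace` linter flags on every declaration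
set_option linter.dupNamespace false

noncomputable section

namespace Summit.HubbardSuperconductivity.HubbardSuperconductivity.Theorems.WindowInfraredBound.Negative

open Literature.MathematicalPhysics.QuantumLattice Literature.Probability.LatticeModels Matrix Finset
open scoped ComplexOrder ComplexConjugate InnerProductSpace

variable {L : ℕ} [NeZero L]

/-! ### Orthonormality of the paired vectors -/

/-- `n_{k↑} Φ_T = [k ∈ T] Φ_T`. [folklore] -/
theorem momentumNumber_up_mulVec_paired (T : Finset (TorusSite 2 L)) (k : TorusSite 2 L) :
    momentumNumber k 0 *ᵥ ((List.map (fun k : TorusSite 2 L => (pairMode k)ᴴ) T.toList).prod *ᵥ (vacuum : Fock (Orb (FermionTorus 2 L)))) = if k ∈ T then ((List.map (fun k : TorusSite 2 L => (pairMode k)ᴴ) T.toList).prod *ᵥ (vacuum : Fock (Orb (FermionTorus 2 L)))) else 0 := by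
  by_cases hk : k ∈ T
  · rw [if_pos hk, momentumNumber_up_pairedState_of_mem (Finset.mem_toList.2 hk)]
  · rw [if_neg hk, momentumNumber_up_pairedState_of_not_mem (fun h => hk (Finset.mem_toList.1 h))]

/-- A mode occupied in `T` and empty in `T'` makes `Φ_T ⊥ Φ_{T'}` (`n_{k↑}` is Hermitian with
eigenvalues `1` and `0` on them). [folklore] -/
theorem star_paired_dotProduct_paired_eq_zero_of_mem_of_not_mem {T T' : Finset (TorusSite 2 L)}
    {k : TorusSite 2 L} (hk : k ∈ T) (hk' : k ∉ T') : star ((List.map (fun k : TorusSite 2 L => (pairMode k)ᴴ) T.toList).prod *ᵥ (vacuum : Fock (Orb (FermionTorus 2 L)))) ⬝ᵥ ((List.map (fun k : TorusSite 2 L => (pairMode k)ᴴ) T'.toList).prod *ᵥ (vacuum : Fock (Orb (FermionTorus 2 L)))) = 0 := by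
  have h1 : momentumNumber k 0 *ᵥ ((List.map (fun k : TorusSite 2 L => (pairMode k)ᴴ) T.toList).prod *ᵥ (vacuum : Fock (Orb (FermionTorus 2 L)))) = ((List.map (fun k : TorusSite 2 L => (pairMode k)ᴴ) T.toList).prod *ᵥ (vacuum : Fock (Orb (FermionTorus 2 L)))) := by rw [momentumNumber_up_mulVec_paired, if_pos hk]
  have h2 : momentumNumber k 0 *ᵥ ((List.map (fun k : TorusSite 2 L => (pairMode k)ᴴ) T'.toList).prod *ᵥ (vacuum : Fock (Orb (FermionTorus 2 L)))) = 0 := by rw [momentumNumber_up_mulVec_paired, if_neg hk']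
  calc star ((List.map (fun k : TorusSite 2 L => (pairMode k)ᴴ) T.toList).prod *ᵥ (vacuum : Fock (Orb (FermionTorus 2 L)))) ⬝ᵥ ((List.map (fun k : TorusSite 2 L => (pairMode k)ᴴ) T'.toList).prod *ᵥ (vacuum : Fock (Orb (FermionTorus 2 L)))) = star (momentumNumber k 0 *ᵥ ((List.map (fun k : TorusSite 2 L => (pairMode k)ᴴ) T.toList).prod *ᵥ (vacuum : Fock (Orb (FermionTorus 2 L))))) ⬝ᵥ ((List.map (fun k : TorusSite 2 L => (pairMode k)ᴴ) T'.toList).prod *ᵥ (vacuum : Fock (Orb (FermionTorus 2 L)))) := by rw [h1]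
    _ = star ((List.map (fun k : TorusSite 2 L => (pairMode k)ᴴ) T.toList).prod *ᵥ (vacuum : Fock (Orb (FermionTorus 2 L)))) ⬝ᵥ ((momentumNumber k 0)ᴴ *ᵥ ((List.map (fun k : TorusSite 2 L => (pairMode k)ᴴ) T'.toList).prod *ᵥ (vacuum : Fock (Orb (FermionTorus 2 L))))) := by
        rw [star_mulVec, ← dotProduct_mulVec]
    _ = 0 := by rw [momentumNumber_conjTranspose, h2, dotProduct_zero]

/-- **Orthonormality of the paired vectors**: `⟨Φ_T, Φ_{T'}⟩ = [T = T']`. [folklore] -/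
theorem star_paired_dotProduct_paired (T T' : Finset (TorusSite 2 L)) :
    star ((List.map (fun k : TorusSite 2 L => (pairMode k)ᴴ) T.toList).prod *ᵥ (vacuum : Fock (Orb (FermionTorus 2 L)))) ⬝ᵥ ((List.map (fun k : TorusSite 2 L => (pairMode k)ᴴ) T'.toList).prod *ᵥ (vacuum : Fock (Orb (FermionTorus 2 L)))) = if T = T' then 1 else 0 := by
  by_cases h : T = T'
  · rw [if_pos h, h]
    exact star_pairedState_dotProduct_self (Finset.nodup_toList T')
  · rw [if_neg h]
    have hne : ∃ k, (k ∈ T ∧ k ∉ T') ∨ (k ∉ T ∧ k ∈ T') := by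
      by_contra hall
      refine h (Finset.ext fun k => ?_)
      by_cases h1 : k ∈ T
      · by_cases h2 : k ∈ T'
        · exact ⟨fun _ => h2, fun _ => h1⟩
        · exact (hall ⟨k, Or.inl ⟨h1, h2⟩⟩).elim
      · by_cases h2 : k ∈ T'
        · exact (hall ⟨k, Or.inr ⟨h1, h2⟩⟩).elim
        · exact ⟨fun h' => (h1 h').elim, fun h' => (h2 h').elim⟩
    obtain ⟨k, hk⟩ := hne
    rcases hk with ⟨hkT, hkT'⟩ | ⟨hkT, hkT'⟩
    · exact star_paired_dotProduct_paired_eq_zero_of_mem_of_not_mem hkT hkT'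
    · rw [star_dotProduct, star_paired_dotProduct_paired_eq_zero_of_mem_of_not_mem hkT' hkT, star_zero]

omit [NeZero L] in
/-- Gluing an inert block: for `F` disjoint from `K` and `S, S' ⊆ K`, `F ∪ S = F ∪ S' ↔ S = S'`. [folklore] -/
theorem union_eq_union_iff_of_disjoint {F K S S' : Finset (TorusSite 2 L)} (hFK : Disjoint F K)
    (hS : S ⊆ K) (hS' : S' ⊆ K) : F ∪ S = F ∪ S' ↔ S = S' := by
  refine ⟨fun h => ?_, fun h => by rw [h]⟩
  have h1 : (F ∪ S) \ F = S := Finset.union_sdiff_cancel_left (hFK.mono_right hS)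
  have h2 : (F ∪ S') \ F = S' := Finset.union_sdiff_cancel_left (hFK.mono_right hS')
  rw [← h1, ← h2, h]

/-! ### The Dicke superposition: norm and sector -/

/-- **`⟨Ψ, Ψ⟩ = C(|K|, n)`** for the Dicke superposition over `n`-subsets of `K` on top of the inert
block `F` (`F ∩ K = ∅`). [folklore] -/
theorem star_dicke_dotProduct_dicke {F K : Finset (TorusSite 2 L)} (hFK : Disjoint F K) (n : ℕ) :
    star (∑ S ∈ powersetCard n K, (List.map (fun k : TorusSite 2 L => (pairMode k)ᴴ) (F ∪ S).toList).prod *ᵥ (vacuum : Fock (Orb (FermionTorus 2 L)))) ⬝ᵥ (∑ S ∈ powersetCard n K, (List.map (fun k : TorusSite 2 L => (pairMode k)ᴴ) (F ∪ S).toList).prod *ᵥ (vacuum : Fock (Orb (FermionTorus 2 L)))) = ((K.card.choose n : ℕ) : ℂ) := by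
  rw [star_sum, sum_dotProduct]
  simp_rw [dotProduct_sum, star_paired_dotProduct_paired]
  have hS : ∀ S ∈ powersetCard n K, (∑ S' ∈ powersetCard n K, (if F ∪ S = F ∪ S' then (1 : ℂ) else 0)) = 1 := by
    intro S hS
    have hSK : S ⊆ K := (Finset.mem_powersetCard.1 hS).1
    rw [Finset.sum_congr rfl (fun S' hS' =>
      if_congr (union_eq_union_iff_of_disjoint hFK hSK (Finset.mem_powersetCard.1 hS').1) rfl rfl),
      Finset.sum_ite_eq, if_pos hS]
  rw [Finset.sum_congr rfl hS, Finset.sum_const, Finset.card_powersetCard, nsmul_eq_mul, mul_one]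

/-- **`Ψ ∈ szSector (2(|F| + n)) 0`**: every `Φ_{F ∪ S}` carries `|F| + n` up- and as many down-electrons. [folklore] -/
theorem dicke_mem_szSector {F K : Finset (TorusSite 2 L)} (hFK : Disjoint F K) (n : ℕ) :
    (∑ S ∈ powersetCard n K, (List.map (fun k : TorusSite 2 L => (pairMode k)ᴴ) (F ∪ S).toList).prod *ᵥ (vacuum : Fock (Orb (FermionTorus 2 L)))) ∈ szSector (Λ := FermionTorus 2 L) (2 * (F.card + n)) 0 := by
  refine Submodule.sum_mem _ fun S hS => ?_
  obtain ⟨hSK, hSn⟩ := Finset.mem_powersetCard.1 hS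
  have hcard : (F ∪ S).toList.length = F.card + n := by
    rw [Finset.length_toList, Finset.card_union_of_disjoint (hFK.mono_right hSK), hSn]
  have h := pairedState_mem_szSector (L := L) (F ∪ S).toList
  rwa [hcard] at h

/-! ### A weighted pair annihilator on the paired vectors and on the Dicke superposition -/

/-- **`B_W Φ_T = Σ_{k ∈ T} W_k Φ_{T∖k}`** for `B_W = Σ_k W_k b_k`. [folklore] -/
theorem weightedPairMode_mulVec_paired (W : TorusSite 2 L → ℂ) (T : Finset (TorusSite 2 L)) :
    (∑ k : TorusSite 2 L, W k • pairMode k) *ᵥ ((List.map (fun k : TorusSite 2 L => (pairMode k)ᴴ) T.toList).prod *ᵥ (vacuum : Fock (Orb (FermionTorus 2 L)))) = ∑ k ∈ T, W k • ((List.map (fun k : TorusSite 2 L => (pairMode k)ᴴ) (T.erase k).toList).prod *ᵥ (vacuum : Fock (Orb (FermionTorus 2 L)))) := by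
  rw [sum_mulVec, ← Finset.sum_subset (Finset.subset_univ T)]
  · refine Finset.sum_congr rfl fun k hk => ?_
    rw [smul_mulVec, pairMode_mulVec_paired, if_pos hk]
  · intro k _ hk
    rw [smul_mulVec, pairMode_mulVec_paired, if_neg hk, smul_zero]

omit [NeZero L] in
/-- Which lowered vector meets the layer below: for `F ∩ K = ∅`, `S, R ⊆ K` and `k ∈ F ∪ S`,
`F ∪ R = (F ∪ S)∖k ↔ (k ∈ S ∧ S∖k = R)` (a mode removed from the inert block never returns to it). [folklore] -/
theorem union_eq_erase_union_iff {F K S R : Finset (TorusSite 2 L)} (hFK : Disjoint F K)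
    (hS : S ⊆ K) (hR : R ⊆ K) {k : TorusSite 2 L} (hk : k ∈ F ∪ S) :
    F ∪ R = (F ∪ S).erase k ↔ (k ∈ S ∧ S.erase k = R) := by
  constructor
  · intro h
    have hkF : k ∉ F := by
      intro hkF
      have : k ∈ (F ∪ S).erase k := by rw [← h]; exact Finset.mem_union_left _ hkF
      exact (Finset.notMem_erase k _) this
    have hkS : k ∈ S := (Finset.mem_union.1 hk).resolve_left hkF
    refine ⟨hkS, ?_⟩
    rw [Finset.erase_union_distrib, Finset.erase_eq_of_notMem hkF] at h
    exact ((union_eq_union_iff_of_disjoint hFK hR ((Finset.erase_subset _ _).trans hS)).1 h).symm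
  · rintro ⟨hkS, rfl⟩
    have hkF : k ∉ F := Finset.disjoint_left.1 hFK |> fun h' hkF => h' hkF (hS hkS)
    rw [Finset.erase_union_distrib, Finset.erase_eq_of_notMem hkF]

/-- **Matrix elements of `B_W Ψ` against the layer below**: for `R ⊆ K` with `|R| = n - 1` (`n ≥ 1`),
`⟨Φ_{F ∪ R}, B_W Ψ⟩ = Σ_{k ∈ K∖R} W_k` — the `n`-subsets lowering onto `R` are exactly `R ∪ {k}`,
`k ∈ K∖R`, each with amplitude `W_k`. Dicke, Phys. Rev. 93 (1954) 99; Yang, Rev. Mod. Phys. 34 (1962) 694, §5. [folklore] -/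
theorem star_paired_dotProduct_weightedPairMode_mulVec_dicke {F K : Finset (TorusSite 2 L)}
    (hFK : Disjoint F K) (W : TorusSite 2 L → ℂ) {n : ℕ} (hn : 1 ≤ n) {R : Finset (TorusSite 2 L)}
    (hR : R ∈ powersetCard (n - 1) K) :
    star ((List.map (fun k : TorusSite 2 L => (pairMode k)ᴴ) (F ∪ R).toList).prod *ᵥ (vacuum : Fock (Orb (FermionTorus 2 L)))) ⬝ᵥ ((∑ k : TorusSite 2 L, W k • pairMode k) *ᵥ (∑ S ∈ powersetCard n K, (List.map (fun k : TorusSite 2 L => (pairMode k)ᴴ) (F ∪ S).toList).prod *ᵥ (vacuum : Fock (Orb (FermionTorus 2 L))))) = ∑ k ∈ K \ R, W k := by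
  obtain ⟨hRK, hRn⟩ := Finset.mem_powersetCard.1 hR
  rw [mulVec_sum, dotProduct_sum]
  -- the contribution of one `n`-subset `S`
  have hS : ∀ S ∈ powersetCard n K,
      star ((List.map (fun k : TorusSite 2 L => (pairMode k)ᴴ) (F ∪ R).toList).prod *ᵥ (vacuum : Fock (Orb (FermionTorus 2 L)))) ⬝ᵥ ((∑ k : TorusSite 2 L, W k • pairMode k) *ᵥ ((List.map (fun k : TorusSite 2 L => (pairMode k)ᴴ) (F ∪ S).toList).prod *ᵥ (vacuum : Fock (Orb (FermionTorus 2 L))))) =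
        ∑ k : TorusSite 2 L, if (k ∉ R ∧ S = insert k R) then W k else 0 := by
    intro S hS
    obtain ⟨hSK, hSn⟩ := Finset.mem_powersetCard.1 hS
    rw [weightedPairMode_mulVec_paired, dotProduct_sum]
    rw [← Finset.sum_subset (Finset.subset_univ (F ∪ S))]
    · refine Finset.sum_congr rfl fun k hk => ?_
      rw [dotProduct_smul, star_paired_dotProduct_paired, smul_eq_mul]
      have hiff : (F ∪ R = (F ∪ S).erase k) ↔ (k ∉ R ∧ S = insert k R) := by
        rw [union_eq_erase_union_iff hFK hSK hRK hk]
        constructor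
        · rintro ⟨hkS, rfl⟩
          exact ⟨Finset.notMem_erase k S, (Finset.insert_erase hkS).symm⟩
        · rintro ⟨hkR, rfl⟩
          exact ⟨Finset.mem_insert_self k R, Finset.erase_insert hkR⟩
      by_cases hc : k ∉ R ∧ S = insert k R
      · rw [if_pos hc, if_pos (hiff.2 hc), mul_one]
      · rw [if_neg hc, if_neg (fun h => hc (hiff.1 h)), mul_zero]
    · intro k _ hk
      rw [if_neg]
      rintro ⟨-, rfl⟩
      exact hk (Finset.mem_union_right _ (Finset.mem_insert_self k R))
  rw [Finset.sum_congr rfl hS, Finset.sum_comm]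
  -- for each mode `k`, at most one `S` (namely `insert k R`) contributes
  have hk : ∀ k : TorusSite 2 L,
      (∑ S ∈ powersetCard n K, if (k ∉ R ∧ S = insert k R) then W k else 0) =
        if k ∈ K \ R then W k else 0 := by
    intro k
    by_cases hkR : k ∈ R
    · rw [Finset.sum_eq_zero (fun S _ => by rw [if_neg (fun h => h.1 hkR)]), if_neg]
      rw [Finset.mem_sdiff]
      exact fun h => h.2 hkR
    · have hrw : ∀ S ∈ powersetCard n K, (if (k ∉ R ∧ S = insert k R) then W k else 0) =
          if S = insert k R then W k else 0 := by
        intro S _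
        by_cases hSe : S = insert k R
        · rw [if_pos hSe, if_pos ⟨hkR, hSe⟩]
        · rw [if_neg hSe, if_neg (fun h => hSe h.2)]
      rw [Finset.sum_congr rfl hrw, Finset.sum_ite_eq']
      have hmem : insert k R ∈ powersetCard n K ↔ k ∈ K \ R := by
        rw [Finset.mem_powersetCard, Finset.mem_sdiff, Finset.insert_subset_iff,
          Finset.card_insert_of_notMem hkR, hRn]
        constructor
        · rintro ⟨⟨hkK, -⟩, -⟩; exact ⟨hkK, hkR⟩
        · rintro ⟨hkK, -⟩; exact ⟨⟨hkK, hRK⟩, by omega⟩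
      by_cases hkK : k ∈ K \ R
      · rw [if_pos (hmem.2 hkK), if_pos hkK]
      · rw [if_neg (fun h => hkK (hmem.1 h)), if_neg hkK]
  simp_rw [hk]
  rw [← Finset.sum_filter, Finset.filter_mem_eq_inter, Finset.univ_inter]

/-! ### The coherent lower bound (Bessel's inequality over the layer below) -/

/-- **Coherent lower bound.** If `Re W_k ≥ a ≥ 0` on `K` (`F ∩ K = ∅`, `1 ≤ n ≤ |K|`), then
`‖B_W Ψ‖² ≥ C(|K|, n-1) · (a (|K| - n + 1))²`: Bessel's inequality for `B_W Ψ` against the orthonormal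
layer `{Φ_{F ∪ R} : R ⊆ K, |R| = n-1}`, each coefficient being `Σ_{k ∈ K∖R} W_k` with real part
`≥ a |K∖R| = a(|K| - n + 1)`.  Together with `⟨Ψ,Ψ⟩ = C(|K|,n)` and `C(|K|,n-1)(|K|-n+1) = n C(|K|,n)` this is
the Dicke enhancement `‖B_W Ψ‖²/‖Ψ‖² ≥ a² n (|K| - n + 1)`.  Dicke, Phys. Rev. 93 (1954) 99;
Yang, Rev. Mod. Phys. 34 (1962) 694, §5. [folklore] -/
theorem dicke_weightedPairMode_lower_bound {F K : Finset (TorusSite 2 L)} (hFK : Disjoint F K)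
    (W : TorusSite 2 L → ℂ) {n : ℕ} (hn : 1 ≤ n) (hnK : n ≤ K.card) {a : ℝ} (ha : 0 ≤ a)
    (hW : ∀ k ∈ K, a ≤ (W k).re) :
    ((K.card.choose (n - 1) : ℕ) : ℝ) * (a * ((K.card : ℝ) - n + 1)) ^ 2 ≤
      (star ((∑ k : TorusSite 2 L, W k • pairMode k) *ᵥ (∑ S ∈ powersetCard n K, (List.map (fun k : TorusSite 2 L => (pairMode k)ᴴ) (F ∪ S).toList).prod *ᵥ (vacuum : Fock (Orb (FermionTorus 2 L))))) ⬝ᵥ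
        ((∑ k : TorusSite 2 L, W k • pairMode k) *ᵥ (∑ S ∈ powersetCard n K, (List.map (fun k : TorusSite 2 L => (pairMode k)ᴴ) (F ∪ S).toList).prod *ᵥ (vacuum : Fock (Orb (FermionTorus 2 L)))))).re := by
  classical
  set B : Matrix (Finset (Orb (FermionTorus 2 L))) (Finset (Orb (FermionTorus 2 L))) ℂ :=
    ∑ k : TorusSite 2 L, W k • pairMode k with hB
  set x : EuclideanSpace ℂ (Finset (Orb (FermionTorus 2 L))) := WithLp.toLp 2 (B *ᵥ (∑ S ∈ powersetCard n K, (List.map (fun k : TorusSite 2 L => (pairMode k)ᴴ) (F ∪ S).toList).prod *ᵥ (vacuum : Fock (Orb (FermionTorus 2 L)))))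
    with hx
  -- the orthonormal layer below
  set v : ↥(powersetCard (n - 1) K) → EuclideanSpace ℂ (Finset (Orb (FermionTorus 2 L))) :=
    fun R => WithLp.toLp 2 ((List.map (fun k : TorusSite 2 L => (pairMode k)ᴴ) (F ∪ (R : Finset (TorusSite 2 L))).toList).prod *ᵥ (vacuum : Fock (Orb (FermionTorus 2 L)))) with hv_def
  have hv : Orthonormal ℂ v := by
    rw [orthonormal_iff_ite]
    intro i j
    rw [hv_def, ← star_dotProduct_eq_inner, star_paired_dotProduct_paired]
    exact if_congr ((union_eq_union_iff_of_disjoint hFK (Finset.mem_powersetCard.1 i.2).1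
        (Finset.mem_powersetCard.1 j.2).1).trans Subtype.coe_inj) rfl rfl
  have hbessel := hv.sum_inner_products_le x (s := Finset.univ)
  have hxnorm : ‖x‖ ^ 2 = (star (B *ᵥ (∑ S ∈ powersetCard n K, (List.map (fun k : TorusSite 2 L => (pairMode k)ᴴ) (F ∪ S).toList).prod *ᵥ (vacuum : Fock (Orb (FermionTorus 2 L))))) ⬝ᵥ (B *ᵥ (∑ S ∈ powersetCard n K, (List.map (fun k : TorusSite 2 L => (pairMode k)ᴴ) (F ∪ S).toList).prod *ᵥ (vacuum : Fock (Orb (FermionTorus 2 L)))))).re := norm_toLp_sq_eq_re _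
  have hcoef : ∀ i : ↥(powersetCard (n - 1) K),
      ⟪v i, x⟫_ℂ = ∑ k ∈ K \ (i : Finset (TorusSite 2 L)), W k := by
    intro i
    rw [hv_def, hx, ← star_dotProduct_eq_inner, hB,
      star_paired_dotProduct_weightedPairMode_mulVec_dicke hFK W hn i.2]
  have hKn : ((K.card - (n - 1) : ℕ) : ℝ) = (K.card : ℝ) - n + 1 := by
    rw [Nat.cast_sub (by omega), Nat.cast_sub hn]
    push_cast
    ring
  have hnn : 0 ≤ a * ((K.card : ℝ) - n + 1) := by
    refine mul_nonneg ha ?_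
    have : (n : ℝ) ≤ K.card := by exact_mod_cast hnK
    linarith
  have hterm : ∀ i : ↥(powersetCard (n - 1) K),
      (a * ((K.card : ℝ) - n + 1)) ^ 2 ≤ ‖⟪v i, x⟫_ℂ‖ ^ 2 := by
    intro i
    obtain ⟨hiK, hin⟩ := Finset.mem_powersetCard.1 i.2
    rw [hcoef i]
    have hsq : ∀ z : ℂ, z.re ^ 2 ≤ ‖z‖ ^ 2 := fun z => by
      rw [Complex.sq_norm, Complex.normSq_apply]; nlinarith [sq_nonneg z.im]
    refine le_trans ?_ (hsq _)
    have hcard : ((K \ (i : Finset (TorusSite 2 L))).card : ℝ) = (K.card : ℝ) - n + 1 := by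
      rw [Finset.card_sdiff_of_subset hiK, hin, hKn]
    have hre : a * ((K.card : ℝ) - n + 1) ≤ (∑ k ∈ K \ (i : Finset (TorusSite 2 L)), W k).re := by
      rw [Complex.re_sum]
      calc a * ((K.card : ℝ) - n + 1) = ∑ _k ∈ K \ (i : Finset (TorusSite 2 L)), a := by
            rw [Finset.sum_const, nsmul_eq_mul, hcard, mul_comm]
        _ ≤ ∑ k ∈ K \ (i : Finset (TorusSite 2 L)), (W k).re :=
            Finset.sum_le_sum fun k hk => hW k (Finset.mem_sdiff.1 hk).1
    exact pow_le_pow_left₀ hnn hre 2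
  calc ((K.card.choose (n - 1) : ℕ) : ℝ) * (a * ((K.card : ℝ) - n + 1)) ^ 2
      = ∑ _i : ↥(powersetCard (n - 1) K), (a * ((K.card : ℝ) - n + 1)) ^ 2 := by
        rw [Finset.sum_const, Finset.card_univ, Fintype.card_coe, Finset.card_powersetCard,
          nsmul_eq_mul]
    _ ≤ ∑ i : ↥(powersetCard (n - 1) K), ‖⟪v i, x⟫_ℂ‖ ^ 2 := Finset.sum_le_sum fun i _ => hterm i
    _ ≤ ‖x‖ ^ 2 := hbessel
    _ = _ := hxnorm

end Summit.HubbardSuperconductivity.HubbardSuperconductivity.Theorems.WindowInfraredBound.Negative
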